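import Mathlib
import Literature.Analysis.FluidPDE.TypeIAncientMild
import Literature.Analysis.FluidPDE.TypeIAncientMildClassical
import Literature.Analysis.FluidPDE.AncientSimilarityVariables
import Literature.Analysis.FluidPDE.TsaiSelfSimilarBounded
import Literature.Analysis.FluidPDE.ClassicalSolutionRescale
import Literature.Analysis.FluidPDE.ClassicalSolutionGlue
import Literature.Analysis.FluidPDE.SpaceTimeCalculus
import Summits.NavierStokesRegularity.NavierStokesRegularity.Theorems.SymmetryModuliCountForcedSymmetryInteriorVertexVanishing
import HarnessLib

/-!
# Route SymmetryModuliCount — future-vertex soliton Liouville, irrotational leaf (`A = 0`)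

Theorems file serving the crux item stmt-NavierStokesRegularity-4052
(`Summit.NavierStokesRegularity.NavierStokesRegularity.Theses.SymmetryModuliCount.ForcedSymmetry`),
line `time-anchor-bootstrap`, registered stub 2a `stub_futureVertexLiouvilleIrrotational`
(the "Tsai leaf"):

* if a Type-I KNSS-mild ancient field `u ∈ A_C` (`IsTypeIAncientMild C u`) on `(-∞, 0) × ℝ³`
  is annihilated on `t < 0` by the plain SCALING generator about a FUTURE space–time vertex
  `(θ, x_c)`, `θ > 0`, `x_c = -σ⁻¹ a` — `∇u·(a + σx) + σu + 2σ(t − θ)∂ₜu = 0`, `σ ≠ 0` —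
  i.e. `u` is exactly backward self-similar about a blow-up point lying in the future of the
  slab, then `u ≡ 0` on `t < 0`.

## Proof

0. *Normalisation* (`irrot_gen_normalise`). Dividing by `σ`, with `x_c = -σ⁻¹ a`:
   `D(u t)(x)(x − x_c) + u + 2(t − θ)∂ₜu = 0` on `t < 0`.
1. *Euler homogeneity* (`irrot_euler_homogeneity`). For fixed `t < 0`, `x`, the function
   `λ ↦ λ u(θ + λ²(t − θ), x_c + λ(x − x_c))` is defined for `λ > λ₀ = √(θ/(θ − t))` (`< 1`),
   and by the chain rule along the space–time curve (`vertex_hasDerivAt_along` of the sibling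
   file `…InteriorVertexVanishing`; joint differentiability of `u` on the open slab only) its
   derivative is the normalised generator at the moving point, i.e. zero; so it is constant
   on the connected open half-line `(λ₀, ∞) ∋ 1` (`IsOpen.is_const_of_deriv_eq_zero`):
   `u(t, x) = λ u(θ + λ²(t − θ), x_c + λ(x − x_c))`.
2. *Self-similar form* (`irrot_selfSimilar_form`). Taking `λ = √(θ + 1)/√(θ − t)` (time `-1`):
   `u(t, x) = (θ − t)^{-1/2} U((x − x_c)/√(θ − t))` with ONE profile
   `U(y) = √(θ+1) u(−1, x_c + √(θ+1) y)`, bounded by `√(θ+1) C` (Type-I rate at `t = -1`).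
3. *Leray profile* (`irrot_exists_isLerayProfile`). `u` is a classical Navier–Stokes solution
   with a smooth pressure on the window `(-θ-2, 0)`
   (`IsTypeIAncientMild.exists_isClassicalNSSolutionOn_Ioo`, Fabes–Jones–Rivière); recentred
   at the vertex (`IsClassicalNSSolutionOn.comp_add_right`, `.spaceTranslate`) it is
   `lerayBackward (1/2) 0 U` on `(-2θ-2, -θ) ⊆ (-∞, 0)`, so in backward similarity variables
   (`isClassicalNSSolutionOn_iff_isBackwardLeraySolutionOn_lerayOrbit`, Chae–Wolf 2017, §4)
   the orbit is the STEADY profile `U` on an open set of similarity times; Leray's form of the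
   momentum equation at one such time (`IsBackwardLeraySolutionOn.momentum_leray`), with
   vanishing `s`-derivative, is the profile system `IsLerayProfile 1 (1/2) U P` for the
   transformed pressure slice `P`.
4. *Tsai + gauge.* A bounded Leray profile on `ℝ³` is constant (Tsai 1998, Thm 1, `q = ∞`;
   tree theorem `IsLerayProfile.exists_eq_const_of_bounded` = `tsai_selfsimilar_bounded_holds`),
   so every slice `u t` is spatially constant (`= (θ − t)^{-1/2} c`), and the Oseen gauge kills
   slice-constant members of `A_C` (`IsTypeIAncientMild.eq_zero_of_slice_const`). The
   drop-gauge version is false (parasitic soliton `c(θ − t)^{-1/2} e₀`), so the last step is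
   essential.

All cited declarations are proved tree theorems; no named unproved fact is used.

## References

* T.-P. Tsai, *On Leray's self-similar solutions of the Navier–Stokes equations satisfying
  local energy estimates*, Arch. Rational Mech. Anal. 143 (1998) 29–51, Theorem 1 (`q = ∞`).
  [Tsai1998]
* D. Chae, J. Wolf, Comm. PDE 42 (2017) = arXiv:1610.09464, §4 (similarity variables).
  [ChaeWolf2017RemovingDSS]
* G. Koch, N. Nadirashvili, G. Seregin, V. Šverák, Acta Math. 203 (2009) = arXiv:0709.3599,
  §1 and Remark 6.1 (the gauge excluding parasitic solutions). [KochNadirashviliSereginSverak2009]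
* Skeleton: `Cruxes/ForcedSymmetry/Lines/time-anchor-bootstrap.lean`, stub 2a.
-/

noncomputable section

-- the summit and its single sub-problem share the name (CONVENTIONS §1), as in every Theorems file
set_option linter.dupNamespace false

open Set Filter Topology Function
open Literature.Analysis.FluidPDE
open scoped RealInnerProductSpace Laplacian ContDiff

namespace Summit.NavierStokesRegularity.NavierStokesRegularity.Theorems

/-- **Step 0 — normalisation of the scaling generator.** If `σ ≠ 0` and
`D(u t)(x)(a + σx) + σ u + 2σ(t − θ)∂ₜu = 0` on `t < 0`, then with the centre `x_c = -σ⁻¹ a`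
(`a + σx = σ(x − x_c)`) the generator divided by `σ` reads
`D(u t)(x)(x − x_c) + u + 2(t − θ)∂ₜu = 0` on `t < 0`. [folklore] -/
theorem irrot_gen_normalise {u : ℝ → EuclideanSpace ℝ (Fin 3) → EuclideanSpace ℝ (Fin 3)}
    {a : EuclideanSpace ℝ (Fin 3)} {σ θ : ℝ} (hσ : σ ≠ 0)
    (hgen : ∀ t < 0, ∀ x, fderiv ℝ (u t) x (a + σ • x) + σ • u t x +
      (2 * σ * (t - θ)) • timeDeriv u t x = 0) :
    ∀ t < 0, ∀ x, fderiv ℝ (u t) x (x - (-(σ⁻¹ • a))) + u t x +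
      (2 * (t - θ)) • timeDeriv u t x = 0 := by
  intro t ht x
  have key := hgen t ht x
  have e1 : a + σ • x = σ • (x - (-(σ⁻¹ • a))) := by
    rw [sub_neg_eq_add, smul_add, smul_smul, mul_inv_cancel₀ hσ, one_smul, add_comm]
  rw [e1, map_smul, show (2 * σ * (t - θ)) = σ * (2 * (t - θ)) by ring, ← smul_smul,
    ← smul_add, ← smul_add] at key
  exact (smul_eq_zero.1 key).resolve_left hσ

/-- **Step 1 — Euler homogeneity along the backward paraboloids through the future vertex.**
Let `uncurry u` be differentiable on the open slab `(-∞, 0) × ℝ³` and let the normalised scaling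
generator about the vertex `(θ, x_c)`, `0 ≤ θ`, annihilate `u` on `t < 0`:
`D(u t)(x)(x − x_c) + u + 2(t − θ)∂ₜu = 0`. Then for every `t < 0`, `x` and every `λ > 0` with
`θ + λ²(t − θ) < 0`, `u(t, x) = λ u(θ + λ²(t − θ), x_c + λ(x − x_c))`: the function
`λ ↦ λ u(θ + λ²(t − θ), x_c + λ(x − x_c))` has derivative
`u + 2(T − θ)∂ₜu + D(u T)(X)(X − x_c) = 0` at the moving point `(T, X)` (chain rule
`vertex_hasDerivAt_along`), hence is constant on the open half-line `λ > √(θ/(θ − t))` (which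
contains `1` and `λ`). [folklore] -/
theorem irrot_euler_homogeneity {u : ℝ → EuclideanSpace ℝ (Fin 3) → EuclideanSpace ℝ (Fin 3)}
    (hd : DifferentiableOn ℝ (uncurry u) (Iio 0 ×ˢ univ)) {xc : EuclideanSpace ℝ (Fin 3)} {θ : ℝ}
    (hθ : 0 ≤ θ)
    (hgen : ∀ t < 0, ∀ x, fderiv ℝ (u t) x (x - xc) + u t x +
      (2 * (t - θ)) • timeDeriv u t x = 0)
    {t : ℝ} (ht : t < 0) (x : EuclideanSpace ℝ (Fin 3)) {l : ℝ} (hl : 0 < l)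
    (hlt : θ + l ^ 2 * (t - θ) < 0) :
    u t x = l • u (θ + l ^ 2 * (t - θ)) (xc + l • (x - xc)) := by
  obtain ⟨T, hT_def⟩ : ∃ T : ℝ → ℝ, T = fun r => θ + r ^ 2 * (t - θ) := ⟨_, rfl⟩
  obtain ⟨X, hX_def⟩ : ∃ X : ℝ → EuclideanSpace ℝ (Fin 3), X = fun r => xc + r • (x - xc) :=
    ⟨_, rfl⟩
  have hθt : 0 < θ - t := by linarith
  -- the parameter domain `J = (l₀, ∞)`, `l₀ = √(θ/(θ - t)) < 1`, on which `T < 0`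
  have hJT : ∀ r ∈ Ioi (Real.sqrt (θ / (θ - t))), T r < 0 := by
    intro r hr
    rw [mem_Ioi] at hr
    have hr0 : 0 < r := (Real.sqrt_nonneg _).trans_lt hr
    have h1 : θ / (θ - t) < r ^ 2 := (Real.sqrt_lt' hr0).1 hr
    rw [div_lt_iff₀ hθt] at h1
    rw [hT_def]
    show θ + r ^ 2 * (t - θ) < 0
    nlinarith
  have h1J : (1 : ℝ) ∈ Ioi (Real.sqrt (θ / (θ - t))) := by
    rw [mem_Ioi, Real.sqrt_lt' one_pos, one_pow, div_lt_one hθt]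
    linarith
  have hlJ : l ∈ Ioi (Real.sqrt (θ / (θ - t))) := by
    rw [mem_Ioi, Real.sqrt_lt' hl, div_lt_iff₀ hθt]
    nlinarith
  -- velocities of the curves
  have hT' : ∀ r, HasDerivAt T (2 * r * (t - θ)) r := by
    intro r
    rw [hT_def]
    refine (((hasDerivAt_pow 2 r).mul_const (t - θ)).const_add θ).congr_deriv ?_
    norm_num
  have hX' : ∀ r, HasDerivAt X (x - xc) r := by
    intro r
    rw [hX_def]
    have h := ((hasDerivAt_id r).smul_const (x - xc)).const_add xc
    simpa using h
  have hU : IsOpen (Iio (0 : ℝ) ×ˢ (univ : Set (EuclideanSpace ℝ (Fin 3)))) :=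
    isOpen_Iio.prod isOpen_univ
  -- `φ(r) = r • u(T r, X r)` is stationary on `J`
  have hφ : ∀ r ∈ Ioi (Real.sqrt (θ / (θ - t))),
      HasDerivAt (fun s => s • u (T s) (X s)) 0 r := by
    intro r hr
    have hmem : (T r, X r) ∈ Iio (0 : ℝ) ×ˢ (univ : Set (EuclideanSpace ℝ (Fin 3))) :=
      ⟨hJT r hr, mem_univ _⟩
    have hL := ((hd _ hmem).differentiableAt (hU.mem_nhds hmem)).hasFDerivAt
    have hv := vertex_hasDerivAt_along hL (hT' r) (hX' r)
    refine ((hasDerivAt_id' r).fun_smul hv).congr_deriv ?_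
    have key := hgen (T r) (hJT r hr) (X r)
    have e1 : X r - xc = r • (x - xc) := by
      rw [hX_def]
      show xc + r • (x - xc) - xc = r • (x - xc)
      abel
    have e2 : 2 * (T r - θ) = r * (2 * r * (t - θ)) := by
      rw [hT_def]
      show 2 * (θ + r ^ 2 * (t - θ) - θ) = r * (2 * r * (t - θ))
      ring
    rw [e1, e2, map_smul, ← smul_smul] at key
    rw [one_smul, smul_add]
    linear_combination (norm := module) key
  have hconst : (1 : ℝ) • u (T 1) (X 1) = l • u (T l) (X l) :=
    IsOpen.is_const_of_deriv_eq_zero (f := fun s => s • u (T s) (X s)) isOpen_Ioi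
      isPreconnected_Ioi (fun r hr => (hφ r hr).differentiableAt.differentiableWithinAt)
      (fun r hr => (hφ r hr).deriv) h1J hlJ
  have hT1 : T 1 = t := by
    rw [hT_def]
    show θ + 1 ^ 2 * (t - θ) = t
    ring
  have hX1 : X 1 = x := by
    rw [hX_def]
    show xc + (1 : ℝ) • (x - xc) = x
    rw [one_smul]
    abel
  have hTl : T l = θ + l ^ 2 * (t - θ) := by rw [hT_def]
  have hXl : X l = xc + l • (x - xc) := by rw [hX_def]
  rw [one_smul, hT1, hX1, hTl, hXl] at hconst
  exact hconst

/-- **Step 2 — the self-similar form with one profile.** Under the hypotheses of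
`irrot_euler_homogeneity`, for all `t < 0`, `x`:
`u(t, x) = (θ − t)^{-1/2} U((θ − t)^{-1/2}(x − x_c))` with the reference profile
`U(y) = √(θ + 1) u(−1, x_c + √(θ + 1) y)` (Euler homogeneity with
`λ = √(θ + 1)/√(θ − t)`, landing on the slice `t = -1`; Leray 1934, (3.11):
`u(t,x) = (T − t)^{-1/2} U(x/√(T − t))`). [folklore] -/
theorem irrot_selfSimilar_form {u : ℝ → EuclideanSpace ℝ (Fin 3) → EuclideanSpace ℝ (Fin 3)}
    (hd : DifferentiableOn ℝ (uncurry u) (Iio 0 ×ˢ univ)) {xc : EuclideanSpace ℝ (Fin 3)} {θ : ℝ}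
    (hθ : 0 ≤ θ)
    (hgen : ∀ t < 0, ∀ x, fderiv ℝ (u t) x (x - xc) + u t x +
      (2 * (t - θ)) • timeDeriv u t x = 0) {t : ℝ} (ht : t < 0) (x : EuclideanSpace ℝ (Fin 3)) :
    u t x = (Real.sqrt (θ - t))⁻¹ • (Real.sqrt (θ + 1) •
      u (-1) (xc + Real.sqrt (θ + 1) • ((Real.sqrt (θ - t))⁻¹ • (x - xc)))) := by
  have hθt : 0 < θ - t := by linarith
  have hθ1 : 0 < θ + 1 := by linarith
  have hA : 0 < Real.sqrt (θ - t) := Real.sqrt_pos.2 hθt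
  have hB : 0 < Real.sqrt (θ + 1) := Real.sqrt_pos.2 hθ1
  obtain ⟨l, hl_def⟩ : ∃ l : ℝ, l = Real.sqrt (θ + 1) * (Real.sqrt (θ - t))⁻¹ := ⟨_, rfl⟩
  have hl : 0 < l := by rw [hl_def]; exact mul_pos hB (inv_pos.2 hA)
  have hl2 : l ^ 2 = (θ + 1) / (θ - t) := by
    rw [hl_def, mul_pow, inv_pow, Real.sq_sqrt hθ1.le, Real.sq_sqrt hθt.le, div_eq_mul_inv]
  have hq : (θ + 1) / (θ - t) * (t - θ) = -(θ + 1) := by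
    rw [show t - θ = -(θ - t) by ring, mul_neg, div_mul_cancel₀ _ hθt.ne']
  have hTl : θ + l ^ 2 * (t - θ) = -1 := by
    rw [hl2, hq]
    ring
  have key := irrot_euler_homogeneity hd hθ hgen ht x hl (by rw [hTl]; norm_num)
  rw [hTl] at key
  rw [key, smul_smul, smul_smul, hl_def]
  congr 1
  exact mul_comm _ _

/-- **Step 3 — the profile is a Leray profile.** Let `u ∈ A_C` (`IsTypeIAncientMild C u`) have
the exact self-similar form `u(t, x) = (θ − t)^{-1/2} U((θ − t)^{-1/2}(x − x_c))` on `t < 0` about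
a future vertex `(θ, x_c)`, `θ > 0`. Then `U` is a Leray profile with viscosity `1` and rate
`a = ½` for some pressure profile `P` (`IsLerayProfile 1 (1/2) U P`): `u` is classical with a
smooth pressure on the window `(-θ-2, 0)` (`IsTypeIAncientMild.exists_isClassicalNSSolutionOn_Ioo`);
recentred at the vertex it is classical on `(-2θ-2, -θ) ⊆ (-∞, 0)` and reads `lerayBackward ½ 0 U`
there, so its backward similarity orbit is the steady profile `U` on an open set of similarity
times (Chae–Wolf 2017, §4; `isClassicalNSSolutionOn_iff_isBackwardLeraySolutionOn_lerayOrbit`),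
and Leray's form of the momentum equation at the similarity time `s₀ = -log(θ + 1)`
(`IsBackwardLeraySolutionOn.momentum_leray`), whose `s`-derivative vanishes, is the profile
system with `P` the transformed pressure slice at `s₀`. [folklore] -/
theorem irrot_exists_isLerayProfile {C : ℝ} {u : ℝ → EuclideanSpace ℝ (Fin 3) → EuclideanSpace ℝ (Fin 3)}
    (hu : IsTypeIAncientMild C u) {xc : EuclideanSpace ℝ (Fin 3)} {θ : ℝ} (hθ : 0 < θ)
    {U : EuclideanSpace ℝ (Fin 3) → EuclideanSpace ℝ (Fin 3)}
    (hss : ∀ t < 0, ∀ x,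
      u t x = (Real.sqrt (θ - t))⁻¹ • U ((Real.sqrt (θ - t))⁻¹ • (x - xc))) :
    ∃ P : EuclideanSpace ℝ (Fin 3) → ℝ, IsLerayProfile 1 (1 / 2) U P := by
  -- (i) classical on the window `(-θ-2, 0)`
  obtain ⟨p, hcl⟩ := hu.exists_isClassicalNSSolutionOn_Ioo (t₀ := -θ - 2) (by linarith)
  -- (ii) recentre at the vertex: `w t x = u (t + θ) (xc + x)` on `(-2θ-2, -θ)`
  have hset : ((fun t : ℝ => t + θ) ⁻¹' Ioo (-θ - 2) 0) = Ioo (-2 * θ - 2) (-θ) := by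
    ext t
    simp only [mem_preimage, mem_Ioo]
    constructor
    · rintro ⟨h1, h2⟩
      exact ⟨by linarith, by linarith⟩
    · rintro ⟨h1, h2⟩
      exact ⟨by linarith, by linarith⟩
  have hw : IsClassicalNSSolutionOn (Ioo (-2 * θ - 2) (-θ)) 1 0 (fun t x => u (t + θ) (xc + x))
      (fun t x => p (t + θ) (xc + x)) := by
    have h0 := (hcl.comp_add_right θ).spaceTranslate xc
    rw [hset] at h0
    exact h0
  -- (iii) backward similarity variables about the space–time origin of `w`
  have hT0 : Ioo (-2 * θ - 2) (-θ) ⊆ Iio (0 : ℝ) := fun t ht => ht.2.trans (neg_lt_zero.2 hθ)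
  have hL := (isClassicalNSSolutionOn_iff_isBackwardLeraySolutionOn_lerayOrbit isOpen_Ioo hT0).1 hw
  have hS : IsOpen (ancientSimTime ⁻¹' Ioo (-2 * θ - 2) (-θ)) :=
    isOpen_preimage_ancientSimTime isOpen_Ioo
  -- the orbit is the steady profile `U` at every similarity time of the window
  have hUeq : ∀ s ∈ ancientSimTime ⁻¹' Ioo (-2 * θ - 2) (-θ),
      lerayOrbit (fun t x => u (t + θ) (xc + x)) s = U := by
    intro s hs
    have hs' : -Real.exp (-s) ∈ Ioo (-2 * θ - 2) (-θ) := hs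
    funext y
    have ht1 : -Real.exp (-s) + θ < 0 := by linarith [hs'.2]
    rw [lerayOrbit_apply, hss _ ht1, add_sub_cancel_left,
      show θ - (-Real.exp (-s) + θ) = Real.exp (-s) by ring, sqrt_exp_neg, smul_smul, smul_smul,
      mul_inv_cancel₀ (Real.exp_pos _).ne', one_smul, inv_mul_cancel₀ (Real.exp_pos _).ne',
      one_smul]
  -- a similarity time in the window: `s₀ = -log(θ + 1)`, physical time `-(θ + 1)`
  obtain ⟨s₀, hs₀_def⟩ : ∃ s₀ : ℝ, s₀ = -Real.log (θ + 1) := ⟨_, rfl⟩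
  have hs₀ : s₀ ∈ ancientSimTime ⁻¹' Ioo (-2 * θ - 2) (-θ) := by
    show -Real.exp (-s₀) ∈ Ioo (-2 * θ - 2) (-θ)
    rw [hs₀_def, neg_neg, Real.exp_log (by linarith)]
    exact ⟨by linarith, by linarith⟩
  refine ⟨lerayOrbitPressure (fun t x => p (t + θ) (xc + x)) s₀, ?_, ?_, ?_, ?_⟩
  · -- `U ∈ C²`: it is a slice of the jointly smooth orbit
    have h := hL.contDiff_velocity hs₀
    rw [hUeq s₀ hs₀] at h
    exact h.of_le (by norm_cast)
  · exact (hL.contDiff_pressure hs₀).of_le (by norm_cast)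
  · -- Leray's form of the momentum equation at `s₀`, with vanishing `s`-derivative
    intro y
    have hm := hL.momentum_leray hs₀ y
    have htd : timeDerivWithin (ancientSimTime ⁻¹' Ioo (-2 * θ - 2) (-θ))
        (lerayOrbit (fun t x => u (t + θ) (xc + x))) s₀ y = 0 := by
      rw [timeDerivWithin_eq_deriv hS hs₀]
      have hev : (fun s => lerayOrbit (fun t x => u (t + θ) (xc + x)) s y) =ᶠ[𝓝 s₀]
          fun _ => U y := by
        filter_upwards [hS.mem_nhds hs₀] with s hs
        rw [hUeq s hs]
      rw [hev.deriv_eq, deriv_const]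
    rw [htd, zero_add, hUeq s₀ hs₀] at hm
    -- (re-elaborating `Δ U` here would pick a different `FiniteDimensional` instance path;
    -- close the goal by normalisation against `hm` instead)
    linear_combination (norm := module) hm
  · have h := hL.divFree s₀ hs₀
    rw [hUeq s₀ hs₀] at h
    exact h

/-- **Registered stub 2a of line `time-anchor-bootstrap` (future-vertex soliton Liouville,
irrotational leaf `A = 0` — the Tsai leaf).** A Type-I KNSS-mild ancient field `u ∈ A_C`
(`IsTypeIAncientMild C u`) annihilated on `t < 0` by the plain scaling generator about a FUTURE
vertex `(θ, -σ⁻¹a)`, `θ > 0` — `∇u·(a + σx) + σu + 2σ(t − θ)∂ₜu = 0`, `σ ≠ 0` — vanishes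
identically: Euler homogeneity makes `u` exactly backward self-similar about the vertex with one
bounded smooth profile `U` (`irrot_selfSimilar_form`, Type-I rate at `t = -1`), which is a Leray
profile with `ν = 1`, `a = ½` (`irrot_exists_isLerayProfile`); Tsai 1998, Thm 1 (`q = ∞`, tree
theorem `IsLerayProfile.exists_eq_const_of_bounded`) makes `U` constant, so every slice `u t` is
spatially constant and the Oseen gauge kills it (`IsTypeIAncientMild.eq_zero_of_slice_const`).
Signature = `Sig.stub_futureVertexLiouvilleIrrotational` of the skeleton, verbatim. [folklore] -/
theorem stub_futureVertexLiouvilleIrrotational :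
    ∀ (C : ℝ) (u : ℝ → EuclideanSpace ℝ (Fin 3) → EuclideanSpace ℝ (Fin 3)),
      Literature.Analysis.FluidPDE.IsTypeIAncientMild C u →
      ∀ (a : EuclideanSpace ℝ (Fin 3)) (σ θ : ℝ), σ ≠ 0 → 0 < θ →
        (∀ t < 0, ∀ x, fderiv ℝ (u t) x (a + σ • x) + σ • u t x +
          (2 * σ * (t - θ)) • Literature.Analysis.FluidPDE.timeDeriv u t x = 0) →
        ∀ t < 0, ∀ x, u t x = 0 := by
  intro C u hu a σ θ hσ hθ hgen t ht x
  -- Step 0: normalise, centre `xc = -σ⁻¹ a`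
  have hgen' := irrot_gen_normalise hσ hgen
  have hd : DifferentiableOn ℝ (uncurry u) (Iio 0 ×ˢ univ) :=
    hu.contDiffOn.differentiableOn (by simp)
  -- Steps 1–2: the self-similar form with the reference profile `U`
  set xc : EuclideanSpace ℝ (Fin 3) := -(σ⁻¹ • a) with hxc_def
  set U : EuclideanSpace ℝ (Fin 3) → EuclideanSpace ℝ (Fin 3) :=
    fun y => Real.sqrt (θ + 1) • u (-1) (xc + Real.sqrt (θ + 1) • y) with hU_def
  have hss : ∀ t < 0, ∀ x,
      u t x = (Real.sqrt (θ - t))⁻¹ • U ((Real.sqrt (θ - t))⁻¹ • (x - xc)) :=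
    fun t ht x => irrot_selfSimilar_form hd hθ.le hgen' ht x
  -- the profile is bounded (Type-I rate at `t = -1`)
  have hbd : ∃ M : ℝ, ∀ y, ‖U y‖ ≤ M := by
    refine ⟨Real.sqrt (θ + 1) * (C / Real.sqrt (-(-1 : ℝ))), fun y => ?_⟩
    show ‖Real.sqrt (θ + 1) • u (-1) (xc + Real.sqrt (θ + 1) • y)‖ ≤ _
    rw [norm_smul, Real.norm_of_nonneg (Real.sqrt_nonneg _)]
    exact mul_le_mul_of_nonneg_left (hu.norm_le (by norm_num) _) (Real.sqrt_nonneg _)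
  -- Step 3: Leray profile; Step 4: Tsai's theorem and the gauge
  obtain ⟨P, hprof⟩ := irrot_exists_isLerayProfile hu hθ hss
  obtain ⟨c, hc⟩ := hprof.exists_eq_const_of_bounded one_pos (by norm_num) hbd
  have hub : ∀ t < 0, ∀ x, u t x = (fun t => (Real.sqrt (θ - t))⁻¹ • c) t := by
    intro t ht x
    rw [hss t ht x, hc]
  exact hu.eq_zero_of_slice_const hub ht x

end Summit.NavierStokesRegularity.NavierStokesRegularity.Theorems

end
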